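import Summits.CriticalPhenomena.PercolationContinuityZ3.Theorems.PercNearOneGluingNoHeavyConstsCrossMarkerYSplit
import Summits.CriticalPhenomena.PercolationContinuityZ3.Theorems.PercNearOneGluingNoHeavyConstsCrossReachMarkerPinnedEdgeExchanges
import HarnessLib

/-!
# The Y-split placements: the u = z CROSS member for every monotone 0/1 functional, unconditionally (assembly)
# (PAPER-2 track (ii): constants of the CSH family; seat `prim-consts-2`, gen 24 assembly)

builds on p205010 (kernel theorem, internal audit signed; external expert review pending).  Support file (`--supports
stmt-CriticalPhenomena-4575`).  `Consts.crossM2_of_ySplit` (…ConstsCrossMarkerYSplit.lean) + the pinned class `Consts.crossRel_edge_M2_of_markerPinned`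
(…CrossReachMarkerPinnedEdgeExchanges.lean) applied to `F_Y = F·connIndicatorFn s y`: on every placement with `a_X·(c·n − b·b_y′) ≤ b_X·b·n`
the u = z CROSS member `M₂(X)(F) ≥ 0` for EVERY monotone 0/1 functional `F` of the open edge cluster.
[cite: VandenbergHaggstromKahn2005, Thm. 1.2 with Remark 1 (p. 5), Thm. 1.1 (pp. 3–5)]
-/

noncomputable section

namespace Summit.CriticalPhenomena.PercolationContinuityZ3.Theorems

open MeasureTheory Set Literature.Probability.LatticeModels Literature.Probability.Percolation
open scoped Classical

namespace Consts

variable {V : Type} [DecidableEq V] [Fintype V]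

/-- **On the Y-split placements (`a_X(cn − bb_y′) ≤ b_X b n`) the u = z CROSS member holds for every monotone 0/1 functional, unconditionally.**
[cite: VandenbergHaggstromKahn2005, Thm. 1.2 with Remark 1 (p. 5), Thm. 1.1 (pp. 3–5)] -/
theorem crossM2_of_ySplit_all (w : Sym2 V → unitInterval) (s y z : V) (X : Set V) (F : Set (Sym2 V) → ℝ) (hFm : Monotone F)
    (hF01 : ∀ C, F C = 0 ∨ F C = 1)
    (hcond : (prodBernoulli w).real ({ω : BondConfig V | ∀ x ∈ insert s (insert z X), ¬ (openGraph ω).Reachable y x} ∩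
          {ω | ∀ x ∈ insert z X, ¬ (openGraph ω).Reachable s x}) *
        ((prodBernoulli w).real ({ω : BondConfig V | ∀ x ∈ X, ¬ (openGraph ω).Reachable s x} ∩ openConn s z ∩ openConn s y) *
            (prodBernoulli w).real {ω : BondConfig V | (∀ x ∈ insert z X, ¬ (openGraph ω).Reachable s x) ∧ ¬ (openGraph ω).Reachable s y} -
          (prodBernoulli w).real ({ω : BondConfig V | ∀ x ∈ insert z X, ¬ (openGraph ω).Reachable s x} ∩ openConn s y) *
            (prodBernoulli w).real {ω : BondConfig V | (∀ x ∈ X, ¬ (openGraph ω).Reachable s x) ∧ (openGraph ω).Reachable s z ∧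
              ¬ (openGraph ω).Reachable s y}) ≤
      (prodBernoulli w).real ({ω : BondConfig V | ∀ x ∈ insert s X, ¬ (openGraph ω).Reachable y x} ∩
            {ω | ∀ x ∈ X, ¬ (openGraph ω).Reachable s x} ∩ openConn y z) *
          (prodBernoulli w).real ({ω : BondConfig V | ∀ x ∈ insert z X, ¬ (openGraph ω).Reachable s x} ∩ openConn s y) *
        (prodBernoulli w).real {ω : BondConfig V | (∀ x ∈ insert z X, ¬ (openGraph ω).Reachable s x) ∧ ¬ (openGraph ω).Reachable s y}) :
    0 ≤ polMargin (prodBernoulli w) s y z F (insert z X) (insert z X) X +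
          polMargin (prodBernoulli w) s y z F (insert z X) X (insert z X) +
        polMargin (prodBernoulli w) s y z F X (insert z X) (insert z X) := by
  refine crossM2_of_ySplit w s y z X F hFm (fun C => by rcases hF01 C with h | h <;> simp [h]) hcond ?_
  -- the pinned part `F_Y = F · connIndicatorFn s y` is a monotone 0/1 functional with `F_Y(C_s) = 1 ⟹ s~y`
  refine crossRel_edge_M2_of_markerPinned w s y z X (fun C => F C * connIndicatorFn s y C) ?_ ?_ ?_
  · intro C C' hCC'
    exact mul_le_mul (hFm hCC') (monotone_connIndicatorFn s y hCC') (by unfold connIndicatorFn; split_ifs <;> norm_num)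
      (by rcases hF01 C' with h | h <;> simp [h])
  · intro C
    rcases hF01 C with h | h
    · left; simp [h]
    · unfold connIndicatorFn; split_ifs <;> simp [h]
  · intro ω h1
    rw [connIndicatorFn_openEdgeCluster] at h1
    by_contra hy
    rw [indicator_of_notMem (show ω ∉ openConn s y from hy), mul_zero] at h1
    exact zero_ne_one h1

end Consts

end Summit.CriticalPhenomena.PercolationContinuityZ3.Theorems

end
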